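import Summits.NavierStokesRegularity.NavierStokesRegularity.Theorems.RootDecompReynoldsHorizonFloor
import HarnessLib

/-!
# Route `RootDecompReynoldsHorizon` (N13): aside `EnergyCeiling` (item stmt-NavierStokesRegularity-28922) — closing link

The proof is `Theorems.RootDecompReynoldsHorizonFloor.energyCeiling_proof` (lens-5 g22 «THE REYNOLDS FLOOR»,
landed with workitem stmt-NavierStokesRegularity-28921 `NoLowReynoldsBlowup`); this file is the by-name
closing link for `EnergyCeiling` (def-free port of the lens-5 g5 kernel 5a: mean value on B(x, |f x|/2G)
+ energy ⟹ |f x|^5 |B₁| ≤ 32 E G³).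
-/

set_option linter.dupNamespace false

namespace Summit.NavierStokesRegularity.NavierStokesRegularity.Theorems.RootDecompReynoldsHorizonEnergyCeiling

/-- **`EnergyCeiling`, item stmt-NavierStokesRegularity-28922** (route `RootDecompReynoldsHorizon`): PROVED
(`RootDecompReynoldsHorizonFloor.energyCeiling_proof`). [cite: KochNadirashviliSereginSverak2009, §4] -/
theorem energyCeiling_holds :
    Summit.NavierStokesRegularity.NavierStokesRegularity.Theses.RootDecompReynoldsHorizon.EnergyCeiling :=
  RootDecompReynoldsHorizonFloor.energyCeiling_proof

end Summit.NavierStokesRegularity.NavierStokesRegularity.Theorems.RootDecompReynoldsHorizonEnergyCeiling
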